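import Literature.NumberTheory.EllipticCurves.OrdinaryNewformDatumSelfDualTwist
import Literature.NumberTheory.EllipticCurves.CofreeTwistCongruenceProofs
import HarnessLib

/-!
# The member congruence (b) for the SELF-DUAL lattice: `A^†_{g_m}[p^m] ≅ (E[p^∞] ⊗ 𝒪)[p^m]` as `𝒪[G_ℚ]`-modules, for a
# Hida member of weight `k_m ≡ 2 (mod 2(p−1)p^{m−1})`

Cell `bsd-stepL`, seat `bsd-stepL-imc-p1` g24 — TWIST AUDIT of crux `ErratumThm23SigmaLe` (item stmt-BirchSwinnertonDyer-25505),
repair step (R3) (memo `HOME/imc-p1/g24/TWIST-AUDIT-25505-imc-p1-g24.md`): helper for Road FF (crux `IMCDivAtErratumDataAllR`,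
item stmt-BirchSwinnertonDyer-20169). Theorems only (0 def ∕ 0 fact ∕ 0 sorry).

## What is proved

The tree's Hida member `D : Skinner2016.HidaCongruentMember W p m` carries the congruence (b) of [Ski16 §2.6 (2-6-1)] ∕ the
erratum's proof of Thm. 1.1 for the UNTWISTED lattice `D.Δ.ρ` (`det = ε^{k−1}`): an `𝒪`-linear `G_ℚ`-equivariant
`e : A_{g_m}[p^m] ≃ (E[p^∞] ⊗ 𝒪)[p^m]` (`D.exists_equivariant_equiv`). The erratum's own `A_{g_m}` is the SELF-DUAL Tate twist
(§2, p. 2: «Let `V_g` be the self-dual Tate twist … `T_g ⊂ V_g` … [Nek92, § 3] … `A_g := V_g/T_g`»), i.e. the tree's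
`D.Δ.selfDualRep = D.Δ.ρ ⊗ ε^{1−k/2}` (`OrdinaryNewformDatumSelfDualTwist`). When `2(p−1)p^{m−1} ∣ k_m − 2` the twisting
character `ε^{1−k_m/2}` is `≡ 1 (mod p^m)` on all of `G_ℚ` (`selfDualTwistChar_sub_one_dvd`: Euler in `ℤ/p^m`,
`CofreeTwistCongruenceProofs`), so the SAME `e` is `G_ℚ`-equivariant for the self-dual lattice
(`exists_equivariant_equiv_selfDual`, and its restriction to `Γ_K`, `exists_equivariant_equiv_selfDual_restrict` — the hypothesis
`h` of the kernel's `BigRep.nonempty_torsionRepIso_pow m κ (D.Δ.selfDualCofreeRepOver K) ((curveCoeffRep W D.ι).restrict …)`).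
Print chooses exactly such members ([Castella2018Erratum] proof of Thm. 1.1 (a)(b): members of weight `k_m → 2` `p`-adically with
«`T_{g_m}/p^m T_{g_m} ≃ T/p^m T`» for the self-dual `T_{g_m}`; the divisibility `2(p−1)p^{m−1} ∣ k_m − 2` is what that sentence
needs and what Hida theory supplies). Nothing about `p`-adic `L`-functions or Selmer groups is asserted; no crux is closed.

[cite: Castella2018Erratum, §2 (p. 2) and proof of Thm. 1.1 (p. 4, (a)(b))] [cite: Skinner2016PacificMC, §2.6 (2-6-1), §3.1 (b)]
-/

noncomputable section

-- D-0017: single-problem summit, the namespace repeats the problem name by design.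
set_option linter.dupNamespace false

open Field CongruenceSubgroup
open Literature.NumberTheory.GaloisRepresentations
open Literature.NumberTheory.EllipticCurves Literature.NumberTheory.EllipticCurves.ModularForms
open Literature.NumberTheory.EllipticCurves.GreenbergSelmer Literature.NumberTheory.EllipticCurves.BigGaloisRep
open Literature.NumberTheory.EllipticCurves.Skinner2016
open scoped MatrixGroups ModularForm

namespace Summit.BirchSwinnertonDyer.BirchSwinnertonDyer.Theorems.SelfDualTwist

/-! ### `ε^{1−k/2} ≡ 1 (mod p^m)` when `2(p−1)p^{m−1} ∣ k − 2` -/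

section Char

variable {M : ℕ} {k : ℤ} {g : CuspForm (Gamma0 M) k} {p : ℕ} [Fact p.Prime]
  (ι : coeffField g →+* PadicAlgCl p)

/-- Values of the self-dual twisting character: `ε^{1−k/2}(σ)` is the unit `Units.map (ℤ_p → 𝒪) (ε(σ))` raised to `1 − k/2`.
[cite: Castella2018Erratum, §2 (p. 2, "the self-dual Tate twist")] -/
theorem selfDualTwistChar_apply (σ : absoluteGaloisGroup ℚ) :
    selfDualTwistChar ι σ =
      Units.map (algebraMap ℤ_[p] (padicCoeffIntegers ι) : ℤ_[p] →* padicCoeffIntegers ι)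
        (GaloisRep.cyclotomicCharacter ℚ p σ) ^ (1 - k / 2) := by
  rw [selfDualTwistChar_def, ContinuousMonoidHom.zpow_apply]
  rfl

/-- **`ε^{1−k/2} ≡ 1 (mod p^m)` on `G_ℚ` when `2(p−1)p^{m−1} ∣ k − 2`** (`m ≥ 1`): `p^m ∣ ε^{1−k/2}(σ) − 1` in `𝒪` for every
`σ`. Indeed `1 − k/2 = −(p−1)p^{m−1}·c` and `u^{(p−1)p^{m−1}} ≡ 1 (mod p^m)` for `u ∈ ℤ_pˣ` (Euler; tree
`pow_dvd_units_map_zpow_sub_one`). [cite: Castella2018Erratum, proof of Thm. 1.1 (p. 4, (a) "`k_m ≡ 2 (mod p − 1)`" with (b) for the self-dual `T_{g_m}`)] -/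
theorem selfDualTwistChar_sub_one_dvd {m : ℕ} (hm : 1 ≤ m)
    (hk : (2 * ((p : ℤ) - 1) * (p : ℤ) ^ (m - 1)) ∣ k - 2) (σ : absoluteGaloisGroup ℚ) :
    ((p : ℕ) : padicCoeffIntegers ι) ^ m ∣ ((selfDualTwistChar ι σ : (padicCoeffIntegers ι)ˣ) : padicCoeffIntegers ι) - 1 := by
  have hp : p.Prime := Fact.out
  have hp1 : 1 ≤ p := hp.one_lt.le
  obtain ⟨c, hc⟩ := hk
  have hj : (((p - 1) * p ^ (m - 1) : ℕ) : ℤ) ∣ (1 - k / 2) := by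
    refine ⟨-c, ?_⟩
    have h2 : k = 2 + 2 * (((p : ℤ) - 1) * (p : ℤ) ^ (m - 1) * c) := by linear_combination hc
    have hdiv : k / 2 = 1 + ((p : ℤ) - 1) * (p : ℤ) ^ (m - 1) * c := by
      rw [h2, show (2 : ℤ) + 2 * (((p : ℤ) - 1) * (p : ℤ) ^ (m - 1) * c) =
        2 * (1 + ((p : ℤ) - 1) * (p : ℤ) ^ (m - 1) * c) by ring]
      exact Int.mul_ediv_cancel_left _ two_ne_zero
    rw [hdiv]
    push_cast [Nat.cast_sub hp1]
    ring
  rw [selfDualTwistChar_apply]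
  exact_mod_cast pow_dvd_units_map_zpow_sub_one (O := padicCoeffIntegers ι) (GaloisRep.cyclotomicCharacter ℚ p σ) hm hj

end Char

/-! ### The congruence (b) for the self-dual lattice of a Hida member -/

section Member

variable {W : WeierstrassCurve ℚ} [W.IsGloballyMinimal] {p : ℕ} [Fact p.Prime] {m : ℕ}
  (D : HidaCongruentMember W p m)

/-- **(b†) — the member congruence for the SELF-DUAL lattice.** For a Hida member `D` at level `m ≥ 1` whose weight satisfies
`2(p−1)p^{m−1} ∣ k_m − 2`, there is an `𝒪`-linear `e : A^†_{g_m}[p^m] ≃ (E[p^∞] ⊗_{ℤ_p} 𝒪)[p^m]` which is `G_ℚ`-equivariant for the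
self-dual action `D.Δ.selfDualCofreeRep` (lattice `D.Δ.selfDualRep = D.Δ.ρ ⊗ ε^{1−k/2}`) and `ρ_{E,p} ⊗ 1 = curveCoeffRep W D.ι`
— the SAME `e` as the untwisted congruence `D.exists_equivariant_equiv` (the twist is `≡ 1 (mod p^m)`,
`selfDualTwistChar_sub_one_dvd`; generic transport `exists_equivariant_equiv_torsion_twist`). This is print's (b) read with print's
own (self-dual) `T_{g_m}`. [cite: Castella2018Erratum, §2 (p. 2) and proof of Thm. 1.1 (p. 4, (a)(b))] [cite: Skinner2016PacificMC, §3.1 (b) (p. 192)] -/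
theorem exists_equivariant_equiv_selfDual (hm : 1 ≤ m)
    (hk : (2 * ((p : ℤ) - 1) * (p : ℤ) ^ (m - 1)) ∣ D.k - 2) :
    ∃ e : Submodule.torsionBy (padicCoeffIntegers D.ι) (Cofree D.Δ.selfDualRep (padicCoeffField D.ι))
        (((p : ℕ) : padicCoeffIntegers D.ι) ^ m) ≃ₗ[padicCoeffIntegers D.ι] CurveCoeffTorsion (p := p) W D.ι m,
      ∀ (σ : absoluteGaloisGroup ℚ)
        (a : Submodule.torsionBy (padicCoeffIntegers D.ι) (Cofree D.Δ.selfDualRep (padicCoeffField D.ι))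
          (((p : ℕ) : padicCoeffIntegers D.ι) ^ m)),
        (e (torsionRep D.Δ.selfDualCofreeRep (((p : ℕ) : padicCoeffIntegers D.ι) ^ m) σ a) :
            CurveCoeffModule (p := p) W D.ι) =
          curveCoeffRep W D.ι σ (e a : CurveCoeffModule (p := p) W D.ι) := by
  -- the generic transport, stated for `FramedRep.twist D.Δ.ρ (selfDualTwistChar D.ι)` (= `D.Δ.selfDualRep` by definition)
  have h := exists_equivariant_equiv_torsion_twist (padicCoeffField D.ι) D.Δ.ρ (selfDualTwistChar D.ι)
    (hasOpenDenominators_padicCoeffIntegers D.ι) (selfDualTwistChar_sub_one_dvd D.ι hm hk)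
    (CurveCoeffTorsion (p := p) W D.ι m) (fun σ x ↦ curveCoeffRep W D.ι σ x) D.exists_equivariant_equiv
  exact h

/-- **(b†) restricted to `Γ_K`** for a number field `K` (the erratum works over `G_K ≤ G_ℚ`): the `∃`-form that is VERBATIM the
hypothesis `h` of the kernel's `BigRep.nonempty_torsionRepIso_pow m κ (D.Δ.selfDualCofreeRepOver K)
((curveCoeffRep W D.ι).restrict (absGaloisRestrict ℚ K))` — the self-dual twin of `D.exists_equivariant_equiv_restrict`.
[cite: Castella2018Erratum, proof of Thm. 1.1, (b) and Lemma 2.1 (pp. 2, 4)] -/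
theorem exists_equivariant_equiv_selfDual_restrict (hm : 1 ≤ m)
    (hk : (2 * ((p : ℤ) - 1) * (p : ℤ) ^ (m - 1)) ∣ D.k - 2) (K : Type) [Field K] [NumberField K] :
    ∃ e : Submodule.torsionBy (padicCoeffIntegers D.ι) (Cofree D.Δ.selfDualRep (padicCoeffField D.ι))
        (((p : ℕ) : padicCoeffIntegers D.ι) ^ m) ≃ₗ[padicCoeffIntegers D.ι] CurveCoeffTorsion (p := p) W D.ι m,
      ∀ (σ : absoluteGaloisGroup K)
        (a : Submodule.torsionBy (padicCoeffIntegers D.ι) (Cofree D.Δ.selfDualRep (padicCoeffField D.ι))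
          (((p : ℕ) : padicCoeffIntegers D.ι) ^ m)),
        (e (torsionRep (D.Δ.selfDualCofreeRepOver K) (((p : ℕ) : padicCoeffIntegers D.ι) ^ m) σ a) :
            CurveCoeffModule (p := p) W D.ι) =
          ((curveCoeffRep W D.ι).restrict (absGaloisRestrict ℚ K)) σ (e a : CurveCoeffModule (p := p) W D.ι) := by
  -- (`Exists.imp`, not `obtain`: destructuring this `∃` package makes `isDefEq` time out)
  refine (exists_equivariant_equiv_selfDual D hm hk).imp fun e he σ a ↦ ?_
  -- `(A^†|_K)[p^m](σ) = A^†[p^m](res σ)` definitionally (`ContinuousRep.restrict`), as in `HidaCongruentMember.he_restrict`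
  exact he (absGaloisRestrict ℚ K σ) a

end Member

end Summit.BirchSwinnertonDyer.BirchSwinnertonDyer.Theorems.SelfDualTwist

end
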